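import Summits.ResolutionOfSingularities.ResolutionOfSingularities.Theorems.EquisingularLiftEquisingularLiftNatCarrierDeltaRegular
import HarnessLib

/-!
# [OURS · L1 W4.5(b) · EL♮(3)] B7★ CONE-DELTA TRANSPORT, carrier side (1/2): the carrier's blow-up chart `A₀[ū/ū_j]` at a point of
# a LOCALISED POLYNOMIAL carrier `A₀ = Λ[U₁,U₂]_𝔫` is a localisation of the polynomial blow-up chart `Λ[X,Y]`
# (`U_j = X_j`, `U_l = X_j·X_l`), and the strict transform of a cone is regular there as soon as it is in `Λ[X,Y]`
# (crux `EquisingularLiftNatThree` stmt-ResolutionOfSingularities-20148 / parent 20038; rung v7 TC⁺, brick `inv_base`)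

NOT a statement of any manuscript. Helper file of the chain res-L1-w45b (cell `res-hironaka`, LADDER-RESOLUTION rung L, slot W4.5(b));
OURS; AI-written, weaker than expert review; `--supports stmt-ResolutionOfSingularities-20148 --as helper` by res-L1-w45b-stub-3 (object
B7★ of the K8/INV board, res-L1-w45b-stub-1 RULING 2026-08-27T13:44:20Z / res-L1-w45b-plan-1 ACK 13:46:12Z, consuming res-L1-w45b-stub-2's
K8 (γ) `coneDeltaRegular_of_carrier_of_rsop`, p535712). No `sorry`; standard axioms. It closes nothing by itself.

WHERE IT SITS. res-L1-w45b-stub-1's `TCPlus.ConeDeltaRegular c Φ` (…NatSubchainSupplierInvDefs, p532383) is the Δ-regularity clause of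
a `TCPlus.CentredPackage` at the cone point `p_c` of the stage: `A = 𝒪_{X₁,p_c}`, frame `c = (e₀, u₁, u₂)` (`e₀` the carrier
equation, `(c)` the ideal of the section `s_c` through `p_c`), cone form `Φ′ ∈ A[Z₁,Z₂]_m`. res-L1-w45b-stub-2's K8 (γ) (p535712,
`coneDeltaRegular_of_carrier(_of_rsop)`) reduces it to a hypothesis (H-model) living in the CARRIER `A₀ = A/(e₀)`: for each chart
`j` of the blow-up of `A₀` along `(ū₁, ū₂)`, every prime `𝔮` of `B̄ = A₀[ū/ū_j]` over the closed point containing the strict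
transform `Φ̄′(ē)`, and every model `T` of `B̄_𝔮`, the ring `T ⧸ (Φ̄′(ē))` is regular. In the suppliers the carrier is the
exceptional divisor `E ≅ ℙ²_O` of the blow-up of a section, so `A₀ = 𝒪_{E,p_c}` IS A LOCALISATION `Λ[U₁,U₂]_𝔫` of a polynomial
ring (`Λ = O`; `ψ : Λ[U] → A₀`, `ψ(U_l) = ū_l`), and the cone is the regrouping of the plane germ `F = Φ(1, U₁, U₂)` of
res-L1-w45b-stub-1's T-ΔLIFT-CENTRED lift `Φ ∈ O[T₀,T₁,T₂]_d` (p523916), whose chart clauses say: on the two charts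
`(U₁,U₂) = (X, XY)`, `(XY, Y)` the strict transforms `Φu = F(X,XY)/Xᵐ`, `Φv = F(XY,Y)/Yᵐ` have regular local rings
`(O[X,Y]/(Φu))_Q` at every prime `Q ∋ ϖ`. THIS FILE is the ring-theoretic core (one chart `j`, abstract `A₀`); part 2
(…NatConeDeltaTransport) assembles the (H-model) hypothesis of (γ) verbatim and `ConeDeltaRegular` itself.

* `planeChart_loc_*` — bookkeeping for a ring map `ψ : R → A₀` presenting `A₀` as `R_𝔫` (injective, domain, units, fractions);
* `planeChartHom_comp_subst` — the chart map `β_j : Λ[X,Y] → B̄`, `X_j ↦ ū_j/1`, `X_l ↦ ū_l/ū_j`, constants through `ψ`,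
  satisfies `β_j ∘ κ_j = (A₀ → B̄) ∘ ψ` for the chart substitution `κ_j : U_j ↦ X_j, U_l ↦ X_j X_l`;
* `planeChartHom_injective` — `β_j` is injective (`Λ` a domain): inside `A₀[1/ū_j]` it is `ψ[1/U_j] ∘ λ_j` with
  `λ_j : Λ[X,Y] → Λ[U][1/U_j]` a section of `κ_j[1/U_j]`;
* **`isLocalization_planeChart`** — `B̄ = A₀[ū/ū_j]` is the localisation of `Λ[X,Y]` along `β_j` at `κ_j(Λ[U] ∖ 𝔫)` (blowing up
  commutes with localisation, here by hand: `B̄` is generated by the `ū_l/ū_j` over `A₀`, Literature `blowupAlgebra.eval_surjective`);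
* **`isRegularLocalRing_quot_of_planeChart`** — hence every model `T` of `B̄_𝔮` (`𝔮` over `𝔪_{A₀}`, `𝔮 ∋ Φ̄′(ē)`) is a localisation
  of `Λ[X,Y]` at a prime `P ∋ ϖ, Φ_j` (`β_j(Φ_j) = Φ̄′(ē)` by the cone identity `ū_jᵐ·Φ̄′(ē) = F(ū) = β_j(X_jᵐ Φ_j)` in the domain
  `B̄`, res-type-100 …NatConeChart `algebraMap_eval_eq_pow_mul_coneTransform`), and `T/(Φ̄′(ē)) ≅ (Λ[X,Y]/(Φ_j))_P` is regular
  (localisation commutes with quotients, res-type-100 `isRegularLocalRing_quotient_map_of_isLocalization`, …NatCarrierDeltaRegular).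

References: The Stacks Project, Tags 052P, 0805, 00KW; U. Görtz, T. Wedhorn, *Algebraic Geometry I* (2020), (13.19) p. 415,
Prop. 13.91 (2), Prop. 13.96 (2) p. 416 [cite: GortzWedhorn2020]; H. Matsumura, *Commutative Ring Theory* (1986), Thm. 14.2
[cite: Matsumura1987]. Tree inputs: p535712 (γ), p523916 (chart clause shape), …NatConeChart, …NatCarrierDeltaRegular,
Literature BlowupAlgebraPresentation / BlowupAlgebraDerivations.
-/

set_option linter.dupNamespace false -- mandated namespace `Summit.<Summit>.<Problem>` of this single-conjunct summit

noncomputable section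

namespace Summit.ResolutionOfSingularities.ResolutionOfSingularities.Cruxes.EquisingularLiftNat.Sections.TCPlus

open MvPolynomial IsLocalRing Literature.AlgebraicGeometry.Resolution
open Summit.ResolutionOfSingularities.ResolutionOfSingularities.Cruxes.EquisingularLiftNat.Sections

universe u

/-! ## A ring map presenting `A₀` as a localisation at a prime: the facts used -/

section LocFacts

variable {R A₀ : Type u} [CommRing R] [CommRing A₀] (ψ : R →+* A₀) (𝔫 : Ideal R) [𝔫.IsPrime]

/-- A localisation map of a domain at a prime is injective. [folklore] -/
theorem planeChart_loc_injective [IsDomain R] (hloc : @IsLocalization.AtPrime _ _ A₀ _ ψ.toAlgebra 𝔫 _) :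
    Function.Injective ψ := by
  letI := ψ.toAlgebra
  haveI := hloc
  exact IsLocalization.injective A₀ (Ideal.primeCompl_le_nonZeroDivisors 𝔫)

/-- A localisation of a domain at a prime is a domain. [folklore] -/
theorem planeChart_loc_isDomain [IsDomain R] (hloc : @IsLocalization.AtPrime _ _ A₀ _ ψ.toAlgebra 𝔫 _) : IsDomain A₀ := by
  letI := ψ.toAlgebra
  haveI := hloc
  exact IsLocalization.isDomain_of_le_nonZeroDivisors A₀ (Ideal.primeCompl_le_nonZeroDivisors 𝔫)

/-- Elements off the prime become units. [folklore] -/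
theorem planeChart_loc_isUnit (hloc : @IsLocalization.AtPrime _ _ A₀ _ ψ.toAlgebra 𝔫 _) {s : R} (hs : s ∉ 𝔫) :
    IsUnit (ψ s) := by
  letI := ψ.toAlgebra
  haveI := hloc
  exact IsLocalization.map_units A₀ (⟨s, hs⟩ : 𝔫.primeCompl)

/-- Every element is a fraction `ψ f / ψ s`, `s ∉ 𝔫`. [folklore] -/
theorem planeChart_loc_exists_mul_eq (hloc : @IsLocalization.AtPrime _ _ A₀ _ ψ.toAlgebra 𝔫 _) (a : A₀) :
    ∃ f s : R, s ∉ 𝔫 ∧ a * ψ s = ψ f := by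
  letI := ψ.toAlgebra
  haveI := hloc
  obtain ⟨⟨f, s⟩, h⟩ := IsLocalization.surj 𝔫.primeCompl a
  exact ⟨f, s, s.2, h⟩

/-- A localisation at a prime is a local ring. [folklore] -/
theorem planeChart_loc_isLocalRing (hloc : @IsLocalization.AtPrime _ _ A₀ _ ψ.toAlgebra 𝔫 _) : IsLocalRing A₀ := by
  letI := ψ.toAlgebra
  haveI := hloc
  exact IsLocalization.AtPrime.isLocalRing A₀ 𝔫

/-- `ψ f` lies in the maximal ideal iff `f ∈ 𝔫`. [folklore] -/
theorem planeChart_loc_mem_maximalIdeal_iff [IsLocalRing A₀] (hloc : @IsLocalization.AtPrime _ _ A₀ _ ψ.toAlgebra 𝔫 _)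
    (f : R) : ψ f ∈ maximalIdeal A₀ ↔ f ∈ 𝔫 := by
  letI := ψ.toAlgebra
  haveI := hloc
  exact IsLocalization.AtPrime.to_map_mem_maximal_iff A₀ 𝔫 f

end LocFacts

/-! ## The chart map `β_j : Λ[X,Y] → A₀[ū/ū_j]` -/

section PlaneChart

variable {Λ : Type u} [CommRing Λ] {A₀ : Type u} [CommRing A₀]
  (ψ : MvPolynomial (Fin 2) Λ →+* A₀) (𝔫 : Ideal (MvPolynomial (Fin 2) Λ)) [𝔫.IsPrime]
  (x : Fin 2 → A₀) (j' : Fin 2)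

/-- **`β_j ∘ κ_j = (A₀ → B̄) ∘ ψ`** for the chart map `β_j : X_j ↦ ū_j/1, X_l ↦ ū_l/ū_j` (constants through `ψ`) and the chart
substitution `κ_j : U_j ↦ X_j, U_l ↦ X_j·X_l` (`ψ(U_l) = ū_l`). [cite: GortzWedhorn2020, (13.19) p. 415] -/
theorem planeChartHom_comp_subst (hx : ∀ l, ψ (X l) = x l) :
    (MvPolynomial.eval₂Hom ((algebraMap A₀ (blowupAlgebra (Ideal.span (Set.range x)) (x j'))).comp (ψ.comp MvPolynomial.C))
        (fun l => if l = j' then algebraMap A₀ (blowupAlgebra (Ideal.span (Set.range x)) (x j')) (x j')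
          else blowupAlgebra.frac x j' l)).comp
      (MvPolynomial.aeval (R := Λ) fun l : Fin 2 =>
        if l = j' then (X j' : MvPolynomial (Fin 2) Λ) else X j' * X l).toRingHom =
    (algebraMap A₀ (blowupAlgebra (Ideal.span (Set.range x)) (x j'))).comp ψ := by
  refine MvPolynomial.ringHom_ext (fun a => ?_) (fun l => ?_)
  · simp only [RingHom.comp_apply, AlgHom.toRingHom_eq_coe, RingHom.coe_coe, MvPolynomial.algHom_C,
      MvPolynomial.algebraMap_eq, MvPolynomial.eval₂Hom_C]
  · by_cases h : l = j'
    · subst h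
      rw [RingHom.comp_apply, AlgHom.toRingHom_eq_coe, RingHom.coe_coe, MvPolynomial.aeval_X, if_pos rfl,
        MvPolynomial.eval₂Hom_X', if_pos rfl, RingHom.comp_apply, hx]
    · rw [RingHom.comp_apply, AlgHom.toRingHom_eq_coe, RingHom.coe_coe, MvPolynomial.aeval_X, if_neg h, map_mul,
        MvPolynomial.eval₂Hom_X', if_pos rfl, MvPolynomial.eval₂Hom_X', if_neg h, RingHom.comp_apply, hx l]
      exact blowupAlgebra.algebraMap_mul_gen _ _ _ _

/-- **The chart map `β_j : Λ[X,Y] → A₀[ū/ū_j]` is injective** when `Λ` is a domain and `A₀ = Λ[U]_𝔫` along `ψ`: composed with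
`A₀[ū/ū_j] ⊆ A₀[1/ū_j]` it is `ψ[1/U_j] ∘ λ_j`, where `λ_j : X_j ↦ U_j/1, X_l ↦ U_l/U_j` is a section of the localised chart
substitution `κ_j[1/U_j]` (so `λ_j` is injective) and `ψ[1/U_j] : Λ[U][1/U_j] → A₀[1/ū_j]` is injective with `ψ`. [folklore] -/
theorem planeChartHom_injective [IsDomain Λ] (hloc : @IsLocalization.AtPrime _ _ A₀ _ ψ.toAlgebra 𝔫 _)
    (hx : ∀ l, ψ (X l) = x l) :
    Function.Injective (MvPolynomial.eval₂Hom
      ((algebraMap A₀ (blowupAlgebra (Ideal.span (Set.range x)) (x j'))).comp (ψ.comp MvPolynomial.C))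
      (fun l => if l = j' then algebraMap A₀ (blowupAlgebra (Ideal.span (Set.range x)) (x j')) (x j')
        else blowupAlgebra.frac x j' l)) := by
  classical
  have hxfun : x = fun l => ψ (X l) := funext fun l => (hx l).symm
  subst hxfun
  have hψinj := planeChart_loc_injective ψ 𝔫 hloc
  haveI := planeChart_loc_isDomain ψ 𝔫 hloc
  have hXj : (X j' : MvPolynomial (Fin 2) Λ) ≠ 0 := MvPolynomial.X_ne_zero j'
  have hxj : ψ (X j') ≠ 0 := fun h => hXj (hψinj (by rw [h, map_zero]))
  set B := blowupAlgebra (Ideal.span (Set.range fun l => ψ (X l))) ((fun l => ψ (X l)) j') with hB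
  set β := MvPolynomial.eval₂Hom ((algebraMap A₀ B).comp (ψ.comp MvPolynomial.C))
      (fun l => if l = j' then algebraMap A₀ B ((fun l => ψ (X l)) j') else blowupAlgebra.frac (fun l => ψ (X l)) j' l)
    with hβ
  -- `λ_j : Λ[X,Y] → Λ[U][1/U_j]` (the ambient localisations are `Λ[U][1/U_j]` and `A₀[1/ū_j]`)
  let lam : MvPolynomial (Fin 2) Λ →+* Localization.Away (X j' : MvPolynomial (Fin 2) Λ) :=
    MvPolynomial.eval₂Hom ((algebraMap (MvPolynomial (Fin 2) Λ) (Localization.Away (X j' : MvPolynomial (Fin 2) Λ))).comp (MvPolynomial.C (σ := Fin 2) (R := Λ)))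
    (fun l => if l = j' then algebraMap (MvPolynomial (Fin 2) Λ) (Localization.Away (X j' : MvPolynomial (Fin 2) Λ)) (X j')
      else IsLocalization.mk' (Localization.Away (X j' : MvPolynomial (Fin 2) Λ)) (X l : MvPolynomial (Fin 2) Λ) ⟨X j', Submonoid.mem_powers _⟩)
  -- `κ_j[1/U_j]`
  have hκ : Submonoid.powers (X j' : MvPolynomial (Fin 2) Λ) ≤ (Submonoid.powers (X j' : MvPolynomial (Fin 2) Λ)).comap
      (MvPolynomial.aeval (R := Λ) fun l : Fin 2 => if l = j' then (X j' : MvPolynomial (Fin 2) Λ) else X j' * X l).toRingHom := by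
    rw [Submonoid.powers_le, Submonoid.mem_comap, AlgHom.toRingHom_eq_coe, RingHom.coe_coe, MvPolynomial.aeval_X, if_pos rfl]
    exact Submonoid.mem_powers _
  let κL : Localization.Away (X j' : MvPolynomial (Fin 2) Λ) →+* Localization.Away (X j' : MvPolynomial (Fin 2) Λ) :=
    IsLocalization.map (Localization.Away (X j' : MvPolynomial (Fin 2) Λ))
    (MvPolynomial.aeval (R := Λ) fun l : Fin 2 => if l = j' then (X j' : MvPolynomial (Fin 2) Λ) else X j' * X l).toRingHom hκ
  -- `κ_j[1/U_j] ∘ λ_j = (Λ[X,Y] → Λ[X,Y][1/X_j])`, so `λ_j` is injective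
  have hκlam : κL.comp lam = algebraMap (MvPolynomial (Fin 2) Λ) (Localization.Away (X j' : MvPolynomial (Fin 2) Λ)) := by
    refine MvPolynomial.ringHom_ext (fun a => ?_) (fun l => ?_)
    · simp only [RingHom.comp_apply, lam, MvPolynomial.eval₂Hom_C, κL, IsLocalization.map_eq, AlgHom.toRingHom_eq_coe,
        RingHom.coe_coe, MvPolynomial.algHom_C, MvPolynomial.algebraMap_eq]
    · by_cases h : l = j'
      · subst h
        simp only [RingHom.comp_apply, lam, MvPolynomial.eval₂Hom_X', if_true, κL, IsLocalization.map_eq,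
          AlgHom.toRingHom_eq_coe, RingHom.coe_coe, MvPolynomial.aeval_X]
      · simp only [RingHom.comp_apply, lam, MvPolynomial.eval₂Hom_X', if_neg h, κL, IsLocalization.map_mk']
        have hval : ((MvPolynomial.aeval (R := Λ) fun l : Fin 2 =>
            if l = j' then (X j' : MvPolynomial (Fin 2) Λ) else X j' * X l).toRingHom (X l)) = X j' * X l := by
          rw [AlgHom.toRingHom_eq_coe, RingHom.coe_coe, MvPolynomial.aeval_X, if_neg h]
        have hval' : ((MvPolynomial.aeval (R := Λ) fun l : Fin 2 =>
            if l = j' then (X j' : MvPolynomial (Fin 2) Λ) else X j' * X l).toRingHom (X j')) = X j' := by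
          rw [AlgHom.toRingHom_eq_coe, RingHom.coe_coe, MvPolynomial.aeval_X, if_pos rfl]
        have : (⟨(MvPolynomial.aeval (R := Λ) fun l : Fin 2 => if l = j' then (X j' : MvPolynomial (Fin 2) Λ) else X j' * X l).toRingHom
            (X j'), hκ (Submonoid.mem_powers _)⟩ : Submonoid.powers (X j' : MvPolynomial (Fin 2) Λ)) =
            ⟨X j', Submonoid.mem_powers _⟩ := Subtype.ext hval'
        rw [this, hval]
        exact IsLocalization.mk'_mul_cancel_left (M := Submonoid.powers (X j' : MvPolynomial (Fin 2) Λ)) (X l)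
          ⟨X j', Submonoid.mem_powers _⟩
  have hlam : Function.Injective lam := by
    have h : Function.Injective (κL.comp lam) := by
      rw [hκlam]
      exact IsLocalization.injective (Localization.Away (X j' : MvPolynomial (Fin 2) Λ))
        (powers_le_nonZeroDivisors_of_noZeroDivisors hXj)
    exact Function.Injective.of_comp (f := κL) (by simpa only [RingHom.coe_comp] using h)
  -- `ψ[1/U_j] : Λ[U][1/U_j] → A₀[1/ū_j]` is injective
  have hψM : Submonoid.powers (X j' : MvPolynomial (Fin 2) Λ) ≤ (Submonoid.powers (ψ (X j'))).comap ψ := by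
    rw [Submonoid.powers_le, Submonoid.mem_comap]
    exact Submonoid.mem_powers _
  haveI : IsLocalization ((Submonoid.powers (X j' : MvPolynomial (Fin 2) Λ)).map ψ) (Localization.Away (ψ (X j'))) := by
    rw [Submonoid.map_powers]
    exact Localization.isLocalization
  let ψL : Localization.Away (X j' : MvPolynomial (Fin 2) Λ) →+* Localization.Away (ψ (X j')) :=
    IsLocalization.map (Localization.Away (ψ (X j'))) ψ hψM
  have hψL : Function.Injective ψL :=
    IsLocalization.map_injective_of_injective (Submonoid.powers (X j' : MvPolynomial (Fin 2) Λ))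
      (Localization.Away (X j' : MvPolynomial (Fin 2) Λ)) (Localization.Away (ψ (X j'))) hψinj
  -- `β_j` followed by `B̄ ⊆ A₀[1/ū_j]` is `ψ[1/U_j] ∘ λ_j`
  have hcomp : (B.val.toRingHom).comp β = ψL.comp lam := by
    refine MvPolynomial.ringHom_ext (fun a => ?_) (fun l => ?_)
    · simp only [RingHom.comp_apply, hβ, MvPolynomial.eval₂Hom_C, lam, ψL, IsLocalization.map_eq, AlgHom.toRingHom_eq_coe,
        RingHom.coe_coe, Subalgebra.coe_val, Subalgebra.coe_algebraMap]
    · by_cases h : l = j'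
      · subst h
        simp only [RingHom.comp_apply, hβ, MvPolynomial.eval₂Hom_X', if_true, lam, ψL, IsLocalization.map_eq,
          AlgHom.toRingHom_eq_coe, RingHom.coe_coe, Subalgebra.coe_val, Subalgebra.coe_algebraMap]
      · simp only [RingHom.comp_apply, hβ, MvPolynomial.eval₂Hom_X', if_neg h, lam, ψL, IsLocalization.map_mk',
          AlgHom.toRingHom_eq_coe, RingHom.coe_coe, Subalgebra.coe_val, blowupAlgebra.coe_frac]
        rw [IsLocalization.Away.invSelf, ← IsLocalization.mk'_eq_mul_mk'_one]
  intro F₁ F₂ h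
  have h' : (B.val.toRingHom).comp β F₁ = (B.val.toRingHom).comp β F₂ := by
    simp only [RingHom.comp_apply, h]
  rw [hcomp] at h'
  exact hlam (hψL h')

/-- **Blowing up commutes with localisation, on the chart: `B̄ = A₀[ū/ū_j]` is the localisation of `Λ[X,Y]` along `β_j` at
`κ_j(Λ[U] ∖ 𝔫)`** (`A₀ = Λ[U]_𝔫` along `ψ`, `Λ` a domain). Units: `β_j(κ_j s) = ψ(s)/1`; fractions: `B̄` is generated over
`A₀` by the `ū_l/ū_j = β_j(X_l)` (Literature `blowupAlgebra.eval_surjective`) and `A₀ = ψ(Λ[U])·ψ(Λ[U] ∖ 𝔫)⁻¹`; kernel: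
`β_j` is injective. [cite: GortzWedhorn2020, Prop. 13.91 (2) p. 415] [OURS · L1 W4.5b] B7★; NOT a statement of the manuscript. -/
theorem isLocalization_planeChart [IsDomain Λ] (hloc : @IsLocalization.AtPrime _ _ A₀ _ ψ.toAlgebra 𝔫 _)
    (hx : ∀ l, ψ (X l) = x l) :
    @IsLocalization _ _ (Submonoid.map (MvPolynomial.aeval (R := Λ) fun l : Fin 2 =>
        if l = j' then (X j' : MvPolynomial (Fin 2) Λ) else X j' * X l) 𝔫.primeCompl)
      (blowupAlgebra (Ideal.span (Set.range x)) (x j')) _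
      (MvPolynomial.eval₂Hom ((algebraMap A₀ (blowupAlgebra (Ideal.span (Set.range x)) (x j'))).comp (ψ.comp MvPolynomial.C))
        (fun l => if l = j' then algebraMap A₀ (blowupAlgebra (Ideal.span (Set.range x)) (x j')) (x j')
          else blowupAlgebra.frac x j' l)).toAlgebra := by
  classical
  set B := blowupAlgebra (Ideal.span (Set.range x)) (x j') with hB
  set β := MvPolynomial.eval₂Hom ((algebraMap A₀ B).comp (ψ.comp MvPolynomial.C))
      (fun l => if l = j' then algebraMap A₀ B (x j') else blowupAlgebra.frac x j' l) with hβ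
  set κ := (MvPolynomial.aeval (R := Λ) fun l : Fin 2 => if l = j' then (X j' : MvPolynomial (Fin 2) Λ) else X j' * X l) with hκ
  letI := β.toAlgebra
  have hβκ : ∀ f, β (κ f) = algebraMap A₀ B (ψ f) := fun f =>
    RingHom.congr_fun (planeChartHom_comp_subst ψ x j' hx) f
  have hβX : ∀ l, l ≠ j' → β (X l) = blowupAlgebra.frac x j' l := fun l hl => by
    rw [hβ, MvPolynomial.eval₂Hom_X', if_neg hl]
  refine ⟨?_, ?_, ?_⟩
  · -- units
    rintro ⟨_, s, hs, rfl⟩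
    change IsUnit (β (κ s))
    rw [hβκ]
    exact (planeChart_loc_isUnit ψ 𝔫 hloc hs).map _
  · -- fractions
    intro z
    obtain ⟨H, rfl⟩ := blowupAlgebra.eval_surjective x j' z
    induction H using MvPolynomial.induction_on with
    | C a =>
      obtain ⟨f, s, hs, hfs⟩ := planeChart_loc_exists_mul_eq ψ 𝔫 hloc a
      refine ⟨(κ f, ⟨κ s, s, hs, rfl⟩), ?_⟩
      change blowupAlgebra.eval x j' (MvPolynomial.C a) * β (κ s) = β (κ f)
      rw [blowupAlgebra.eval_C, hβκ, hβκ, ← map_mul, hfs]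
    | add H₁ H₂ h₁ h₂ =>
      obtain ⟨⟨F₁, m₁⟩, e₁⟩ := h₁
      obtain ⟨⟨F₂, m₂⟩, e₂⟩ := h₂
      refine ⟨(F₁ * m₂ + F₂ * m₁, m₁ * m₂), ?_⟩
      change blowupAlgebra.eval x j' H₁ * β (m₁ : MvPolynomial (Fin 2) Λ) = β F₁ at e₁
      change blowupAlgebra.eval x j' H₂ * β (m₂ : MvPolynomial (Fin 2) Λ) = β F₂ at e₂
      change blowupAlgebra.eval x j' (H₁ + H₂) * β ((m₁ : MvPolynomial (Fin 2) Λ) * m₂) = β (F₁ * m₂ + F₂ * m₁)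
      rw [map_add, map_mul, map_add, map_mul, map_mul, ← e₁, ← e₂]
      ring
    | mul_X H w h =>
      obtain ⟨⟨F, m⟩, e⟩ := h
      refine ⟨(F * X w.1, m), ?_⟩
      change blowupAlgebra.eval x j' H * β (m : MvPolynomial (Fin 2) Λ) = β F at e
      change blowupAlgebra.eval x j' (H * MvPolynomial.X w) * β (m : MvPolynomial (Fin 2) Λ) = β (F * X w.1)
      rw [map_mul, blowupAlgebra.eval_X, map_mul, hβX w.1 w.2, ← e]
      ring
  · -- kernel
    intro F₁ F₂ h
    exact ⟨1, by rw [planeChartHom_injective ψ 𝔫 x j' hloc hx h]⟩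

/-- **(H-model) on one chart.** `Λ` a domain, `A₀ = Λ[U₁,U₂]_𝔫` along `ψ` with `C ϖ ∈ 𝔫`, `ū_l = ψ(U_l)`; `Φ̄′ ∈ A₀[Z₁,Z₂]` a form
of degree `m` whose value `Φ̄′(ū)` is `ψ(F)`; on the chart `j`, `κ_j(F) = X_jᵐ · Φ_j` with `(Λ[X,Y]/(Φ_j))_Q` regular at every
prime `Q ∋ ϖ`. THEN for every prime `𝔮` of `B̄ = A₀[ū/ū_j]` over `𝔪_{A₀}` containing the strict transform `Φ̄′(ū/ū_j)` and every
model `T` of `B̄_𝔮`, the ring `T ⧸ (Φ̄′(ū/ū_j))` is a regular local ring: `T` is the localisation of `Λ[X,Y]` at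
`P = β_j⁻¹(𝔮) ∋ ϖ, Φ_j` (`isLocalization_planeChart` + localisation at a prime of a localisation), `β_j(Φ_j) = Φ̄′(ū/ū_j)`
(cancel `ū_jᵐ` in the domain `B̄`), and `T/(Φ_j)T ≅ (Λ[X,Y]/(Φ_j))_P`.
[cite: GortzWedhorn2020, Prop. 13.96 (2) p. 416] [OURS · L1 W4.5b] B7★; NOT a statement of the manuscript. -/
theorem isRegularLocalRing_quot_of_planeChart [IsDomain Λ] [IsLocalRing A₀]
    (hloc : @IsLocalization.AtPrime _ _ A₀ _ ψ.toAlgebra 𝔫 _) {ϖ : Λ} (hϖ : MvPolynomial.C ϖ ∈ 𝔫)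
    (hx : ∀ l, ψ (X l) = x l) {m : ℕ} (Φb : MvPolynomial (Fin 2) A₀) (hΦbd : Φb.IsHomogeneous m)
    (F Fj : MvPolynomial (Fin 2) Λ) (hF : MvPolynomial.eval x Φb = ψ F)
    (hFj : MvPolynomial.aeval (R := Λ) (fun l : Fin 2 => if l = j' then (X j' : MvPolynomial (Fin 2) Λ) else X j' * X l) F =
      X j' ^ m * Fj)
    (hreg : ∀ (Q : Ideal (MvPolynomial (Fin 2) Λ ⧸ Ideal.span {Fj})) [Q.IsPrime],
      Ideal.Quotient.mk (Ideal.span {Fj}) (MvPolynomial.C ϖ) ∈ Q → IsRegularLocalRing (Localization.AtPrime Q))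
    (𝔮 : Ideal (blowupAlgebra (Ideal.span (Set.range x)) (x j'))) [𝔮.IsPrime]
    (h𝔮 : 𝔮.comap (algebraMap A₀ _) = maximalIdeal A₀)
    (hmem : MvPolynomial.aeval (blowupAlgebra.frac x j') Φb ∈ 𝔮)
    (T : Type u) [CommRing T] [Algebra (blowupAlgebra (Ideal.span (Set.range x)) (x j')) T] [IsLocalization.AtPrime T 𝔮] :
    IsRegularLocalRing (T ⧸ Ideal.span {algebraMap _ T (MvPolynomial.aeval (blowupAlgebra.frac x j') Φb)}) := by
  classical
  set β := MvPolynomial.eval₂Hom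
      ((algebraMap A₀ (blowupAlgebra (Ideal.span (Set.range x)) (x j'))).comp (ψ.comp MvPolynomial.C))
      (fun l => if l = j' then algebraMap A₀ (blowupAlgebra (Ideal.span (Set.range x)) (x j')) (x j')
        else blowupAlgebra.frac x j' l) with hβ
  set κ := (MvPolynomial.aeval (R := Λ) fun l : Fin 2 => if l = j' then (X j' : MvPolynomial (Fin 2) Λ) else X j' * X l)
    with hκ
  have hψinj := planeChart_loc_injective ψ 𝔫 hloc
  haveI := planeChart_loc_isDomain ψ 𝔫 hloc
  have hxj : x j' ≠ 0 := by
    rw [← hx]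
    exact fun h => MvPolynomial.X_ne_zero j' (hψinj (by rw [h, map_zero]))
  haveI : IsDomain (Localization.Away (x j')) :=
    IsLocalization.isDomain_localization (powers_le_nonZeroDivisors_of_noZeroDivisors hxj)
  haveI : IsDomain (blowupAlgebra (Ideal.span (Set.range x)) (x j')) := Subalgebra.isDomain _
  have halg : Function.Injective (algebraMap A₀ (blowupAlgebra (Ideal.span (Set.range x)) (x j'))) := fun a b h => by
    have h' : (algebraMap A₀ (blowupAlgebra (Ideal.span (Set.range x)) (x j')) a : Localization.Away (x j')) =
        (algebraMap A₀ (blowupAlgebra (Ideal.span (Set.range x)) (x j')) b : Localization.Away (x j')) := by rw [h]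
    rw [Subalgebra.coe_algebraMap, Subalgebra.coe_algebraMap] at h'
    exact IsLocalization.injective (Localization.Away (x j')) (powers_le_nonZeroDivisors_of_noZeroDivisors hxj) h'
  have hβκ : ∀ f, β (κ f) = algebraMap A₀ (blowupAlgebra (Ideal.span (Set.range x)) (x j')) (ψ f) := fun f =>
    RingHom.congr_fun (planeChartHom_comp_subst ψ x j' hx) f
  -- `β_j(Φ_j) = Φ̄′(ū/ū_j)`
  have hβF : β Fj = MvPolynomial.aeval (blowupAlgebra.frac x j') Φb := by
    have h1 := algebraMap_eval_eq_pow_mul_coneTransform x j' hΦbd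
    have h2 : algebraMap A₀ (blowupAlgebra (Ideal.span (Set.range x)) (x j')) (MvPolynomial.eval x Φb) =
        β (X j') ^ m * β Fj := by
      rw [hF, ← hβκ, ← map_pow, ← map_mul, ← hFj]
    have h3 : β (X j') = algebraMap A₀ (blowupAlgebra (Ideal.span (Set.range x)) (x j')) (x j') := by
      rw [hβ, MvPolynomial.eval₂Hom_X', if_pos rfl]
    rw [h2, h3] at h1
    exact mul_left_cancel₀ (pow_ne_zero m fun h => hxj (halg (by rw [h, map_zero]))) h1
  -- `T` is the localisation of `Λ[X,Y]` at `P = β⁻¹(𝔮)`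
  letI algB : Algebra (MvPolynomial (Fin 2) Λ) (blowupAlgebra (Ideal.span (Set.range x)) (x j')) := β.toAlgebra
  haveI : IsLocalization (Submonoid.map κ 𝔫.primeCompl) (blowupAlgebra (Ideal.span (Set.range x)) (x j')) :=
    isLocalization_planeChart ψ 𝔫 x j' hloc hx
  letI algT : Algebra (MvPolynomial (Fin 2) Λ) T :=
    ((algebraMap (blowupAlgebra (Ideal.span (Set.range x)) (x j')) T).comp β).toAlgebra
  haveI : IsScalarTower (MvPolynomial (Fin 2) Λ) (blowupAlgebra (Ideal.span (Set.range x)) (x j')) T :=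
    IsScalarTower.of_algebraMap_eq fun f => rfl
  haveI hT : IsLocalization.AtPrime T
      (𝔮.comap (algebraMap (MvPolynomial (Fin 2) Λ) (blowupAlgebra (Ideal.span (Set.range x)) (x j')))) :=
    IsLocalization.isLocalization_isLocalization_atPrime_isLocalization (Submonoid.map κ 𝔫.primeCompl) T 𝔮
  have halgβ : algebraMap (MvPolynomial (Fin 2) Λ) (blowupAlgebra (Ideal.span (Set.range x)) (x j')) = β := rfl
  -- `Φ_j ∈ P`, `ϖ ∈ P`
  have hle : Ideal.span {Fj} ≤
      𝔮.comap (algebraMap (MvPolynomial (Fin 2) Λ) (blowupAlgebra (Ideal.span (Set.range x)) (x j'))) := by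
    rw [Ideal.span_singleton_le_iff_mem, Ideal.mem_comap, halgβ, hβF]
    exact hmem
  haveI : ((𝔮.comap (algebraMap (MvPolynomial (Fin 2) Λ) (blowupAlgebra (Ideal.span (Set.range x)) (x j')))).map
      (Ideal.Quotient.mk (Ideal.span {Fj}))).IsPrime :=
    Ideal.map_isPrime_of_surjective Ideal.Quotient.mk_surjective (by rw [Ideal.mk_ker]; exact hle)
  have hϖP : Ideal.Quotient.mk (Ideal.span {Fj}) (MvPolynomial.C ϖ) ∈
      (𝔮.comap (algebraMap (MvPolynomial (Fin 2) Λ) (blowupAlgebra (Ideal.span (Set.range x)) (x j')))).map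
        (Ideal.Quotient.mk (Ideal.span {Fj})) := by
    refine Ideal.mem_map_of_mem _ ?_
    rw [Ideal.mem_comap, halgβ, hβ, MvPolynomial.eval₂Hom_C, RingHom.comp_apply, RingHom.comp_apply, ← Ideal.mem_comap, h𝔮]
    exact (planeChart_loc_mem_maximalIdeal_iff ψ 𝔫 hloc _).mpr hϖ
  -- localisation commutes with quotients
  have key := isRegularLocalRing_quotient_map_of_isLocalization (S := T)
    (𝔮.comap (algebraMap (MvPolynomial (Fin 2) Λ) (blowupAlgebra (Ideal.span (Set.range x)) (x j'))))
    (Ideal.span {Fj}) hle (hreg _ hϖP)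
  have hI : (Ideal.span {Fj}).map (algebraMap (MvPolynomial (Fin 2) Λ) T) =
      Ideal.span {algebraMap (blowupAlgebra (Ideal.span (Set.range x)) (x j')) T
        (MvPolynomial.aeval (blowupAlgebra.frac x j') Φb)} := by
    rw [Ideal.map_span, Set.image_singleton, ← hβF]
    rfl
  rw [hI] at key
  exact key

end PlaneChart

end Summit.ResolutionOfSingularities.ResolutionOfSingularities.Cruxes.EquisingularLiftNat.Sections.TCPlus

end
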